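import Summits.ResolutionOfSingularities.ResolutionOfSingularities.Theorems.EquisingularLiftEquisingularLiftNatSpecimenConeVertexChart
import Mathlib.RingTheory.Nullstellensatz
import Mathlib.RingTheory.MvPolynomial.EulerIdentity
import HarnessLib

/-!
# [OURS] FIRST-ORDER POINTS: the intrinsic criterion «`Φ_μ`, `∇Φ_μ`, `Ψ_{μ+1}` have no common non-zero zero» produces T-ONESTEP's explicit
# strict transforms with their Jacobian certificate — pure algebra, every field, every number of variables
# (cruxes `Theses.EquisingularLift.EquisingularLiftNat` / `…NatThree` / `EquisingularLift`, stmt-ResolutionOfSingularities-20038 / -20148 / -15660)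

[OURS · leafhand-res-equisingularlift-9 g0, 2026-08-31; cell `pub/decomp-res`] AI-produced, weaker than expert review; NOT a statement of any manuscript;
nothing here proves resolution of singularities in positive characteristic.  DEF-FREE helper; no `sorry`; standard axioms; ZERO named hypotheses.

Seat res-D-pv-013's T-ONESTEP ✓ `OneStep.elNatAt_oneStepPoints` (…NatOneStepPoints) resolves a marked vertex `P_c` of the hypersurface `V₊(F)` by ONE
blow-up as soon as, writing the vertex chart `f = F(x_c := 1) = Φ + Ψ` (`Φ ≠ 0` the tangent cone of degree `μ`, `Ψ ∈ (y)^{μ+1}`), one exhibits for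
EVERY chart direction `l` an explicit polynomial `G_l` with the total-transform identity `f(T_l, T_l·T_j) = T_l^μ · G_l` and the Jacobian certificate
«at every prime `P ∋ T_l, G_l` some `∂G_l/∂T_j ∉ P`».  So far this hypothesis (hone) was verified specimen by specimen through polynomial identities
(✓ `ThreeA2Cubic.oneStep_data`).  This file derives (hone) ONCE AND FOR ALL from the intrinsic FIRST-ORDER CRITERION of the singularity: split one more
homogeneous piece, `f = Φ + Ψ₁ + Ψ'` with `Ψ₁` a form of degree `μ + 1` and `Ψ' ∈ (y)^{μ+2}`, and ask

  (FO) every prime ideal of `K[y]` containing `Φ`, all `∂Φ/∂y_i` and `Ψ₁` contains every `y_i`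

(projectively: the singular locus of the tangent cone `V(Φ) ⊂ ℙ(T_P)` does not meet `V(Ψ₁)`; classically: the strict transform of `V(f)` under the
blow-up of the origin is non-singular along the exceptional divisor).  Ordinary multiple points (`V(Φ)` non-singular) are the case where `Ψ₁` is not
needed; `A₂` surface points `y₀y₁ + y₂³ + …` (the singular point `[0:0:1]` of the cone `y₀y₁` is not on `y₂³ = 0`) and the characteristic-2 nodes
`y₀y₁ + y₂² + …` (the form `y₀y₁ + y₂²` has all partials vanishing at `[0:0:1]`, which is not on the conic) are first-order points that are NOT ordinary.

* `FirstOrderPoint.pderiv_aeval_update_of_ne` / `pderiv_aeval_update_self` — the chain rule for the dehomogenisation `y_l := 1`: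
  `∂_j (φ(ŷ)) = (∂_j φ)(ŷ)` for `j ≠ l`, `∂_l (φ(ŷ)) = 0` (`ŷ = (y with y_l := 1)`);
* `FirstOrderPoint.aeval_subst_of_isHomogeneous` — `Φ(T_l, T_lT_j) = T_l^μ · Φ(T̂)` for a form of degree `μ` (✓ `Cone.aeval_smul_eq_pow_mul_aeval`);
* `FirstOrderPoint.exists_aeval_subst_eq_pow_mul` — `Ψ'(T_l, T_lT_j) ∈ T_l^k · K[T]` for `Ψ' ∈ (y)^k`;
* `FirstOrderPoint.aeval_update_pderiv_self_mem` — EULER: if `Φ(ŷ)` and the `(∂_jΦ)(ŷ)`, `j ≠ l`, lie in an ideal, so does `(∂_lΦ)(ŷ)`;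
* ★ `FirstOrderPoint.exists_strictTransform` — **(FO) ⇒ (hone)**: for every `l` the polynomial `G_l = Φ(T̂) + T_l·Ψ₁(T̂) + T_l²·R_l` satisfies
  `f(T_l, T_lT_j) = T_l^μ·G_l` and the Jacobian certificate at every prime containing `T_l` (if all `∂_jG_l ∈ P ∋ T_l, G_l` then `Φ(T̂)`, all `(∂_iΦ)(T̂)`
  (Euler for `i = l`) and `Ψ₁(T̂)` lie in `P`, so (FO) applied to the prime `(y ↦ T̂)⁻¹ P` puts `y_l ↦ 1` in `P`);
* `FirstOrderPoint.firstOrder_of_forall_aeval` — over an ALGEBRAICALLY CLOSED field, (FO) follows from its closed-point form «`Φ(b) = 0`, `∇Φ(b) = 0`,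
  `Ψ₁(b) = 0` only for `b = 0`» (Hilbert's Nullstellensatz for prime ideals, Mathlib `MvPolynomial.IsPrime.vanishingIdeal_zeroLocus`).

Honest label: pure algebra; closes no registered stub of 20038 / 20148 / 15660.

References: [Hartshorne1977, I Thm. 5.1, I Ex. 5.8, II Ex. 7.12 (strict transform under the blow-up of a point)]; [Matsumura1987, Thm. 14.2];
Euler's identity (Mathlib `IsHomogeneous.sum_X_mul_pderiv`); Hilbert's Nullstellensatz (Mathlib `RingTheory/Nullstellensatz`).
-/

set_option linter.dupNamespace false -- mandated namespace `Summit.<Summit>.<Problem>` of this single-conjunct summit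

noncomputable section

open MvPolynomial

namespace Summit.ResolutionOfSingularities.ResolutionOfSingularities.Cruxes.EquisingularLiftNat.Sections

namespace FirstOrderPoint

variable (K : Type) [Field K] {n : ℕ}

/-! ## The chain rule for `y_l := 1` -/

/-- **`∂_j (φ(ŷ)) = (∂_j φ)(ŷ)` for `j ≠ l`**, where `ŷ = (y with y_l := 1)`. [folklore] -/
theorem pderiv_aeval_update_of_ne {l j : Fin n} (hjl : j ≠ l) (φ : MvPolynomial (Fin n) K) :
    pderiv j (aeval (Function.update (X : Fin n → MvPolynomial (Fin n) K) l 1) φ) =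
      aeval (Function.update (X : Fin n → MvPolynomial (Fin n) K) l 1) (pderiv j φ) := by
  induction φ using MvPolynomial.induction_on with
  | C a => simp [MvPolynomial.algebraMap_eq]
  | add p q hp hq => simp only [map_add, hp, hq]
  | mul_X p i hp =>
    rw [map_mul, aeval_X, pderiv_mul, hp, pderiv_mul, map_add, map_mul, map_mul, aeval_X]
    congr 1
    by_cases hil : i = l
    · subst hil
      rw [Function.update_self, pderiv_one, pderiv_X_of_ne (Ne.symm hjl), map_zero]
    · rw [Function.update_of_ne hil]
      by_cases hij : i = j
      · subst hij
        rw [pderiv_X_self, map_one]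
      · rw [pderiv_X_of_ne hij, map_zero]

/-- **`∂_l (φ(ŷ)) = 0`**: `φ(ŷ)` does not involve `y_l`. [folklore] -/
theorem pderiv_aeval_update_self (l : Fin n) (φ : MvPolynomial (Fin n) K) :
    pderiv l (aeval (Function.update (X : Fin n → MvPolynomial (Fin n) K) l 1) φ) = 0 := by
  induction φ using MvPolynomial.induction_on with
  | C a => simp [MvPolynomial.algebraMap_eq]
  | add p q hp hq => simp only [map_add, hp, hq, add_zero]
  | mul_X p i hp =>
    rw [map_mul, aeval_X, pderiv_mul, hp, zero_mul, zero_add]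
    by_cases hil : i = l
    · subst hil
      rw [Function.update_self, pderiv_one, mul_zero]
    · rw [Function.update_of_ne hil, pderiv_X_of_ne hil, mul_zero]

/-! ## The total-transform substitution `y_j ↦ T_l·T_j` (`j ≠ l`), `y_l ↦ T_l` on forms and on `(y)^k` -/

/-- **`Φ(T_l, T_l·T_j) = T_l^μ · Φ(T̂)`** for a form `Φ` of degree `μ` (`T̂ = (T with T_l := 1)`). [folklore] -/
theorem aeval_subst_of_isHomogeneous (l : Fin n) {Φ : MvPolynomial (Fin n) K} {μ : ℕ} (hΦ : Φ.IsHomogeneous μ) :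
    aeval (fun j => X l * Function.update (X : Fin n → MvPolynomial (Fin n) K) l 1 j) Φ =
      X l ^ μ * aeval (Function.update (X : Fin n → MvPolynomial (Fin n) K) l 1) Φ :=
  Cone.aeval_smul_eq_pow_mul_aeval hΦ (X l) _

/-- **`Ψ'(T_l, T_l·T_j) ∈ T_l^k · K[T]` for `Ψ' ∈ (y)^k`**: the substitution maps `(y)` into `(T_l)`. [folklore] -/
theorem exists_aeval_subst_eq_pow_mul (l : Fin n) {Ψ : MvPolynomial (Fin n) K} {k : ℕ}
    (hΨ : Ψ ∈ Ideal.span (Set.range (X : Fin n → MvPolynomial (Fin n) K)) ^ k) :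
    ∃ R : MvPolynomial (Fin n) K,
      aeval (fun j => X l * Function.update (X : Fin n → MvPolynomial (Fin n) K) l 1 j) Ψ = X l ^ k * R := by
  set s : MvPolynomial (Fin n) K →ₐ[K] MvPolynomial (Fin n) K :=
    aeval (fun j => X l * Function.update (X : Fin n → MvPolynomial (Fin n) K) l 1 j) with hs
  have hle : Ideal.map s.toRingHom (Ideal.span (Set.range (X : Fin n → MvPolynomial (Fin n) K))) ≤ Ideal.span {(X l : MvPolynomial (Fin n) K)} := by
    rw [Ideal.map_span, Ideal.span_le]
    rintro _ ⟨_, ⟨j, rfl⟩, rfl⟩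
    simp only [AlgHom.toRingHom_eq_coe, RingHom.coe_coe, hs, aeval_X, SetLike.mem_coe]
    exact Ideal.mem_span_singleton.mpr (dvd_mul_right _ _)
  have hmem : s Ψ ∈ Ideal.span {(X l : MvPolynomial (Fin n) K)} ^ k := by
    have h := Ideal.mem_map_of_mem s.toRingHom hΨ
    rw [Ideal.map_pow] at h
    exact Ideal.pow_right_mono hle k h
  rw [Ideal.span_singleton_pow, Ideal.mem_span_singleton] at hmem
  obtain ⟨R, hR⟩ := hmem
  exact ⟨R, hR⟩

/-! ## Euler -/

/-- **EULER for the dehomogenised partials.**  `Φ` a form of degree `μ`, `ŷ = (y with y_l := 1)`: if `Φ(ŷ)` and the `(∂_jΦ)(ŷ)`, `j ≠ l`, lie in an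
ideal `P`, then so does `(∂_lΦ)(ŷ)` — apply `y ↦ ŷ` to `Σ_i y_i·∂_iΦ = μ·Φ`, where the `i = l` summand is `1·(∂_lΦ)(ŷ)`.
[folklore] -/
theorem aeval_update_pderiv_self_mem (l : Fin n) {Φ : MvPolynomial (Fin n) K} {μ : ℕ} (hΦ : Φ.IsHomogeneous μ)
    (P : Ideal (MvPolynomial (Fin n) K))
    (h0 : aeval (Function.update (X : Fin n → MvPolynomial (Fin n) K) l 1) Φ ∈ P)
    (hj : ∀ j, j ≠ l → aeval (Function.update (X : Fin n → MvPolynomial (Fin n) K) l 1) (pderiv j Φ) ∈ P) :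
    aeval (Function.update (X : Fin n → MvPolynomial (Fin n) K) l 1) (pderiv l Φ) ∈ P := by
  have h := congrArg (aeval (Function.update (X : Fin n → MvPolynomial (Fin n) K) l 1)) hΦ.sum_X_mul_pderiv
  rw [map_sum, map_nsmul, ← Finset.add_sum_erase _ _ (Finset.mem_univ l), map_mul, aeval_X, Function.update_self, one_mul] at h
  have h' : aeval (Function.update (X : Fin n → MvPolynomial (Fin n) K) l 1) (pderiv l Φ) =
      μ • aeval (Function.update (X : Fin n → MvPolynomial (Fin n) K) l 1) Φ -
        ∑ i ∈ Finset.univ.erase l, aeval (Function.update (X : Fin n → MvPolynomial (Fin n) K) l 1) (X i * pderiv i Φ) :=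
    eq_sub_of_add_eq h
  rw [h']
  refine P.sub_mem ?_ (P.sum_mem fun i hi => ?_)
  · rw [nsmul_eq_mul]
    exact P.mul_mem_left _ h0
  · rw [map_mul]
    exact P.mul_mem_left _ (hj i (Finset.ne_of_mem_erase hi))

/-! ## ★ The first-order criterion produces the explicit strict transforms with their Jacobian certificate -/

/-- ★ **(FO) ⇒ (hone): FIRST-ORDER POINTS ARE ONE-STEP POINTS, with explicit strict transforms.**  `K` any field; `f = Φ + (Ψ₁ + Ψ')` with `Φ` a form of
degree `μ`, `Ψ₁` a form of degree `μ + 1`, `Ψ' ∈ (y)^{μ+2}`; (FO) every prime containing `Φ`, all `∂Φ/∂y_i` and `Ψ₁` contains all `y_i`.  Then for every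
chart direction `l` there is `G` with the total-transform identity `f(T_l, T_l·T_j) = T_l^μ · G` and such that at every prime `P ∋ T_l, G` some
`∂G/∂T_j ∉ P` — verbatim the per-vertex hypothesis of ✓ `OneStep.elNatAt_oneStepPoints` / ✓ `OneStep.isRegularLocalRing_localization_blowupAlgebra`.
`G = Φ(T̂) + T_l·(Ψ₁(T̂) + T_l·R)`; if all `∂_jG ∈ P` then `(∂_jΦ)(T̂) ∈ P` (`j ≠ l`, chain rule), `Ψ₁(T̂) ∈ P` (`j = l`), `Φ(T̂) ∈ P`, hence `(∂_lΦ)(T̂) ∈ P`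
(Euler), and (FO) for the prime `(y ↦ T̂)⁻¹P` gives `1 = T̂_l ∈ P`. [cite: Hartshorne1977, I Thm. 5.1] -/
theorem exists_strictTransform (Φ Ψ₁ Ψ' : MvPolynomial (Fin n) K) {μ : ℕ} (hΦ : Φ.IsHomogeneous μ) (hΨ₁ : Ψ₁.IsHomogeneous (μ + 1))
    (hΨ' : Ψ' ∈ Ideal.span (Set.range (X : Fin n → MvPolynomial (Fin n) K)) ^ (μ + 2))
    (hcrit : ∀ P : Ideal (MvPolynomial (Fin n) K), P.IsPrime → Φ ∈ P → (∀ i, pderiv i Φ ∈ P) → Ψ₁ ∈ P →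
      ∀ i, (X i : MvPolynomial (Fin n) K) ∈ P)
    (l : Fin n) :
    ∃ G : MvPolynomial (Fin n) K,
      aeval (fun j => X l * Function.update (X : Fin n → MvPolynomial (Fin n) K) l 1 j) (Φ + (Ψ₁ + Ψ')) = X l ^ μ * G ∧
      ∀ P : Ideal (MvPolynomial (Fin n) K), P.IsPrime → (X l : MvPolynomial (Fin n) K) ∈ P → G ∈ P → ∃ j, pderiv j G ∉ P := by
  obtain ⟨R, hR⟩ := exists_aeval_subst_eq_pow_mul K l hΨ'
  set u : Fin n → MvPolynomial (Fin n) K := Function.update (X : Fin n → MvPolynomial (Fin n) K) l 1 with hu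
  refine ⟨aeval u Φ + X l * (aeval u Ψ₁ + X l * R), ?_, ?_⟩
  · rw [map_add, map_add, aeval_subst_of_isHomogeneous K l hΦ, aeval_subst_of_isHomogeneous K l hΨ₁, hR]
    ring
  · intro P hP hXl hG
    by_contra hall
    push Not at hall
    -- `Φ(T̂) ∈ P`
    have hΦu : aeval u Φ ∈ P := by
      have h : aeval u Φ = (aeval u Φ + X l * (aeval u Ψ₁ + X l * R)) - X l * (aeval u Ψ₁ + X l * R) := by ring
      rw [h]
      exact P.sub_mem hG (P.mul_mem_right _ hXl)
    -- the partials `j ≠ l`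
    have hju : ∀ j, j ≠ l → aeval u (pderiv j Φ) ∈ P := by
      intro j hjl
      have h := hall j
      rw [map_add, pderiv_aeval_update_of_ne K hjl, pderiv_mul, pderiv_X_of_ne (Ne.symm hjl), zero_mul, zero_add] at h
      have h' : aeval u (pderiv j Φ) = (aeval u (pderiv j Φ) + X l * pderiv j (aeval u Ψ₁ + X l * R)) -
          X l * pderiv j (aeval u Ψ₁ + X l * R) := by ring
      rw [h']
      exact P.sub_mem h (P.mul_mem_right _ hXl)
    -- `Ψ₁(T̂) ∈ P` (the partial `j = l`)
    have hΨu : aeval u Ψ₁ ∈ P := by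
      have h := hall l
      rw [map_add, pderiv_aeval_update_self K l, zero_add, pderiv_mul, pderiv_X_self, one_mul] at h
      have h' : aeval u Ψ₁ = (aeval u Ψ₁ + X l * R + X l * pderiv l (aeval u Ψ₁ + X l * R)) -
          X l * (R + pderiv l (aeval u Ψ₁ + X l * R)) := by ring
      rw [h']
      exact P.sub_mem h (P.mul_mem_right _ hXl)
    -- Euler: the partial `i = l` too
    have hlu : aeval u (pderiv l Φ) ∈ P := aeval_update_pderiv_self_mem K l hΦ P hΦu hju
    have hall' : ∀ i, aeval u (pderiv i Φ) ∈ P := fun i => by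
      by_cases hil : i = l
      · subst hil; exact hlu
      · exact hju i hil
    -- pull back along `y ↦ T̂`
    set Q : Ideal (MvPolynomial (Fin n) K) := P.comap (aeval u).toRingHom with hQ
    haveI : Q.IsPrime := Ideal.comap_isPrime _ P
    have hmem : ∀ q : MvPolynomial (Fin n) K, q ∈ Q ↔ aeval u q ∈ P := fun q => by rw [hQ, Ideal.mem_comap]; rfl
    have hXQ : (X l : MvPolynomial (Fin n) K) ∈ Q :=
      hcrit Q inferInstance ((hmem Φ).mpr hΦu) (fun i => (hmem _).mpr (hall' i)) ((hmem Ψ₁).mpr hΨu) l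
    rw [hmem, aeval_X, hu, Function.update_self] at hXQ
    exact hP.ne_top ((Ideal.eq_top_iff_one P).mpr hXQ)

/-- **The first-order datum makes `f` a one-step chart**: `Ψ₁ + Ψ' ∈ (y)^{μ+1}`, so `f = Φ + (Ψ₁ + Ψ')` has the shape `Φ + Ψ` of T-ONESTEP.
[folklore] -/
theorem add_mem_pow_succ {Ψ₁ Ψ' : MvPolynomial (Fin n) K} {μ : ℕ} (hΨ₁ : Ψ₁.IsHomogeneous (μ + 1))
    (hΨ' : Ψ' ∈ Ideal.span (Set.range (X : Fin n → MvPolynomial (Fin n) K)) ^ (μ + 2)) :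
    Ψ₁ + Ψ' ∈ Ideal.span (Set.range (X : Fin n → MvPolynomial (Fin n) K)) ^ (μ + 1) := by
  refine Ideal.add_mem _ ?_ (Ideal.pow_le_pow_right (by omega) hΨ')
  change Ψ₁ ∈ MvPolynomial.idealOfVars (Fin n) K ^ (μ + 1)
  refine (MvPolynomial.mem_pow_idealOfVars_iff (μ + 1) Ψ₁).mpr fun d hd => ?_
  have h := hΨ₁ (mem_support_iff.mp hd)
  rw [Finsupp.degree_eq_weight_one]
  exact h.symm.le

/-! ## The closed-point form over an algebraically closed field -/

/-- **(FO) from closed points** (`K` algebraically closed): if `b = 0` is the only common zero in `Kⁿ` of `Φ`, all `∂Φ/∂y_i` and `Ψ₁`, then every prime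
containing them contains all `y_i` — a prime of `K[y]` is the vanishing ideal of its zero locus (Mathlib `MvPolynomial.IsPrime.vanishingIdeal_zeroLocus`),
which here is `⊆ {0}`. [cite: Hartshorne1977, I Thm. 1.3A] -/
theorem firstOrder_of_forall_aeval [IsAlgClosed K] (Φ Ψ₁ : MvPolynomial (Fin n) K)
    (h : ∀ b : Fin n → K, aeval b Φ = 0 → (∀ i, aeval b (pderiv i Φ) = 0) → aeval b Ψ₁ = 0 → b = 0)
    (P : Ideal (MvPolynomial (Fin n) K)) (hP : P.IsPrime) (hΦ : Φ ∈ P) (hd : ∀ i, pderiv i Φ ∈ P) (hΨ : Ψ₁ ∈ P)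
    (i : Fin n) : (X i : MvPolynomial (Fin n) K) ∈ P := by
  rw [← MvPolynomial.IsPrime.vanishingIdeal_zeroLocus (K := K) P, MvPolynomial.mem_vanishingIdeal_iff]
  intro x hx
  rw [MvPolynomial.mem_zeroLocus_iff] at hx
  have hx0 : x = 0 := h x (hx Φ hΦ) (fun j => hx _ (hd j)) (hx Ψ₁ hΨ)
  rw [hx0, aeval_X, Pi.zero_apply]

/-- ★ **(FO, closed-point form) ⇒ (hone)** over an algebraically closed field. [cite: Hartshorne1977, I Thm. 5.1] -/
theorem exists_strictTransform_of_forall_aeval [IsAlgClosed K] (Φ Ψ₁ Ψ' : MvPolynomial (Fin n) K) {μ : ℕ} (hΦ : Φ.IsHomogeneous μ)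
    (hΨ₁ : Ψ₁.IsHomogeneous (μ + 1)) (hΨ' : Ψ' ∈ Ideal.span (Set.range (X : Fin n → MvPolynomial (Fin n) K)) ^ (μ + 2))
    (h : ∀ b : Fin n → K, aeval b Φ = 0 → (∀ i, aeval b (pderiv i Φ) = 0) → aeval b Ψ₁ = 0 → b = 0) (l : Fin n) :
    ∃ G : MvPolynomial (Fin n) K,
      aeval (fun j => X l * Function.update (X : Fin n → MvPolynomial (Fin n) K) l 1 j) (Φ + (Ψ₁ + Ψ')) = X l ^ μ * G ∧
      ∀ P : Ideal (MvPolynomial (Fin n) K), P.IsPrime → (X l : MvPolynomial (Fin n) K) ∈ P → G ∈ P → ∃ j, pderiv j G ∉ P :=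
  exists_strictTransform K Φ Ψ₁ Ψ' hΦ hΨ₁ hΨ' (fun P hP hΦP hdP hΨP => firstOrder_of_forall_aeval K Φ Ψ₁ h P hP hΦP hdP hΨP) l

end FirstOrderPoint

end Summit.ResolutionOfSingularities.ResolutionOfSingularities.Cruxes.EquisingularLiftNat.Sections

end
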